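import Summits.QuantumFields.YangMills.Theorems.BalabanLadderIRColdDoublingRecursionSC
import Summits.QuantumFields.YangMills.Theorems.BalabanLadderIRAbstractBasinRung
import Literature.MathematicalPhysics.QuantumLattice.GaugeGroupsProofs
import Literature.MathematicalPhysics.QuantumLattice.RepLieAlgebraUnitary
import HarnessLib

/-!
# (file 1∕2 — per-representation part)
# `UniformExitAt θ` is false of the femto tower — negative lemmas about the SHAPE of the seed `E = BasinRung.ColdExitAt θ` of crux `IR`
# (stmt-QuantumFields-19354); kernel content of line `femto-wall` (ideator ym-ir-idea-10 g2, lens «negation»; workfile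
# `Cruxes/IR/Lines/femto_wall.lean` a1794751664f carries the same theorems plus the registered-style stubs)

HONEST FRAMING.  Nothing here proves the Yang–Mills mass gap (Clay), the crux `BalabanLadder.IR`, or `E`; R4 closes only the
conditional finite-𝕋⁴ rung `BalabanLadder.UV`.  This module is NEGATIVE KNOWLEDGE about the SHAPE of `E = BasinRung.ColdExitAt θ`
(`∀ β ≫ 1, ∃ L ≥ 8, δᶜ_β(L) ≤ θ`; seed of the desk's bill of record `BasinRung.IR_of_exitAt24`): its width toward `IR` is 0.  Every
statement below is either PROVED outright or PROVED from the explicit hypothesis `FemtoTowerSC` / `FemtoTowerAt r` / `EventualImpurityAt r θ`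
(the femto-universe zero-mode tower at fixed lattice volume — physics-certain, rigorously open here, carried as a HYPOTHESIS, never asserted).

CONTENT (sorry-free):
* §0–§1 the missing direction of the purity/excess dictionary for a trace-positive box: `1/(1+x)² ≤ Z(2t)/Z(t)² ≤ 1/(1+x)`, hence
  `1 − 1/(1+x) ≤ δᶜ_β(L) ≤ 1 − 1/(1+x)²` with `x = coldExcess r β L` (the tree's `AspectBootstrap` had only `δ ≥ 2x/(1+x)²`, useless for large `x`);
* §2 `FemtoImpurityAt r ↔ FemtoTowerAt r` (δᶜ_β(L) → 1 at every fixed `L ≥ 8` iff the thermal excess diverges), `femtoTowerAt_of_rate`;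
* §3 per representation, from `EventualImpurityAt r θ` (implied by the tower for every `θ < 1`): `not_uniformExitAtRep` (no lattice box is
  `θ`-pure at all large `β`), `window_escape` (every bounded window of lattice sizes is eventually impure), `selector_tendsto_atTop` (EVERY
  witness family `β ↦ L(β)` of the seed tends to `+∞`), `not_upwardHeredity` (purity is not inherited upward in `β` at fixed lattice size,
  given cofinal exits — the β-REVERSAL of idea-11's downward heredity `M♭₂` is false);
* §4 class level: `UniformExitAt θ` (the seed with `∃ L` before `∀ β`) implies `BasinRung.ColdExitAt θ` and is FALSE at `SU(2)` for every
  `θ < 1` modulo `FemtoTowerSC` + `π₁(SU(2)) = 1` (`not_uniformExitAt_SU2`) — SHARP on the tolerance axis: `uniformExitAt_iff_one_le :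
  UniformExitAt θ ↔ 1 ≤ θ` (the trivial side `uniformExitAt_of_one_le`, `coldExitAt_of_one_le : 1 ≤ θ → BasinRung.ColdExitAt θ` outright); already `UniformExitAt (1/24)` is false modulo the cheaper typed
  rung `CentreFluxImpuritySU2` (eight 't Hooft electric-flux sectors ⇒ `δᶜ ≥ 7/8 − o(1)`; `not_uniformExit24_of_centreRung`); the selector theorem
  `exitSelectors_diverge` (given `ColdExitAt θ`, witnesses exist and ALL of them diverge in lattice units) and `not_upwardHeredity_of_exitAt`.

READING (director №16 (3) «what makes purity uniform in β», typed): at FIXED LATTICE SIZE nothing does — a unit map / multi-scale passage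
is forced on any proof of `E`; no finite-lattice certificate, however large the box, closes `E`; the only upward heredity compatible with
this wall moves along the diagonal (box doubling per coupling increment: `Cruxes/IR/Lines/diagonal_heredity.lean`).  Group-BLIND within
compact connected Lie groups (SCALE axis; complementary to the GROUP axis of `ColdExitFalseOfLightFlux`).

Refs: Lüscher, Nucl. Phys. B219 (1983) 233 (femto universe); van Baal–Koller, Ann. Phys. 174 (1987) 299; Coste et al., Nucl. Phys. B262 (1985) 67
(zero-momentum modes, finite-box β → ∞); 't Hooft, Nucl. Phys. B153 (1979) 141 (electric flux); van Baal, arXiv:hep-lat/9802029 §7.2.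
Tree: `AspectBootstrap.{HasSpectralDatum, exc, tracePositive}`, `ColdPurityBridge.coldDefect`, `BasinRung.ColdExitAt`.

Landed for item `stmt-QuantumFields-19354` (Negative lane) by the LEAD prover ab-p1 (director-ym №14 (3); critic ym-ir-crit-3 co-sign
06:03:05Z); authored by ideator ym-ir-idea-10 g2 (`pub/ideators/ym-ir-idea-10/landable/UniformExitFalseOfFemtoTower.lean` sha16 9e715129247e632b),
split in two files for the 400-line lint: THIS file = §0–§3 (one-box dictionary, Wilson cold box, femto tower per representation, the per-rep wall);
`UniformExitFalseOfFemtoTower.lean` = §4 (class level: `UniformExitAt`, `FemtoTowerSC`, the sharp threshold, selectors).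

-/

set_option autoImplicit false

noncomputable section

open Filter Topology MeasureTheory
open Literature.MathematicalPhysics.QuantumFieldTheory Literature.MathematicalPhysics.QuantumLattice
open Summit.QuantumFields.YangMills.Cruxes.IR.ColdPurityBridge (coldDefect)
open Summit.QuantumFields.YangMills.Cruxes.IR.AspectBootstrap
  (HasSpectralDatum exc phi exc_nonneg exc_antitone z_eq_exp_mul z_pos tracePositive)
open Summit.QuantumFields.YangMills.Cruxes.IR.BasinRung (ColdExitAt coldExitAt_mono)

namespace Summit.QuantumFields.YangMills.Theorems.ColdExitSC.Negative.FemtoWall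

/-! ## §0 One-box dictionary (abstract, PROVED): `1/(1+x)² ≤ Z(2t)/Z(t)² ≤ 1/(1+x)`, `x = x_t` -/

section OneBox

variable {z : ℕ → ℝ}

/-- The period-doubling ratio in terms of the excesses: `Z(2t)/Z(t)² = (1 + x_{2t})/(1 + x_t)²` (`t = m+2`). -/
theorem ratio_eq_exc (m : ℕ) :
    z (2 * (m + 2)) / z (m + 2) ^ 2 = (1 + exc z (2 * (m + 2))) / (1 + exc z (m + 2)) ^ 2 ∨ 1 + exc z (m + 2) = 0 := by
  by_cases hx0 : 1 + exc z (m + 2) = 0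
  · exact Or.inr hx0
  left
  have e1 := z_eq_exp_mul z m
  have e2 : z (2 * (m + 2)) = Real.exp (((2 * (m + 2) : ℕ) : ℝ) * phi z) * (1 + exc z (2 * (m + 2))) := by
    have := z_eq_exp_mul z (2 * m + 2)
    rwa [show 2 * m + 2 + 2 = 2 * (m + 2) from by ring] at this
  have e3 : Real.exp (((2 * (m + 2) : ℕ) : ℝ) * phi z) = Real.exp (((m + 2 : ℕ) : ℝ) * phi z) ^ 2 := by
    rw [← Real.exp_nat_mul]; push_cast; ring_nf
  have hE : 0 < Real.exp (((m + 2 : ℕ) : ℝ) * phi z) := Real.exp_pos _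
  rw [e2, e3, e1]
  field_simp

/-- **Upper bound on the ratio (NEW direction; the large-excess regime):** `Z(2t)/Z(t)² ≤ 1/(1 + x_t)`, because `x_{2t} ≤ x_t`
(`exc_antitone`).  Equivalently `δ ≥ x/(1+x) = 1 − 1/N_eff`: a large thermal excess forces the defect toward ONE.
(The tree's `one_sub_ratio_ge_of_traceExcess` gives `δ ≥ 2x/(1+x)²`, sharp for small `x` but `→ 0` for large `x`.) -/
theorem ratio_le_inv_one_add_exc (h : HasSpectralDatum z) (m : ℕ) :
    z (2 * (m + 2)) / z (m + 2) ^ 2 ≤ 1 / (1 + exc z (m + 2)) := by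
  have hx1 := exc_nonneg h m
  have hx2 : 0 ≤ exc z (2 * (m + 2)) := by
    rw [show 2 * (m + 2) = (2 * m + 2) + 2 from by ring]; exact exc_nonneg h _
  have hx21 : exc z (2 * (m + 2)) ≤ exc z (m + 2) := by
    rw [show 2 * (m + 2) = (2 * m + 2) + 2 from by ring]; exact exc_antitone h (by omega)
  rcases ratio_eq_exc (z := z) m with hr | h0
  · rw [hr]
    have h1 : (1 + exc z (2 * (m + 2))) / (1 + exc z (m + 2)) ^ 2 ≤ (1 + exc z (m + 2)) / (1 + exc z (m + 2)) ^ 2 :=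
      div_le_div_of_nonneg_right (by linarith) (sq_nonneg _)
    have h2 : (1 + exc z (m + 2)) / (1 + exc z (m + 2)) ^ 2 = 1 / (1 + exc z (m + 2)) := by
      have hx0 : (1 + exc z (m + 2)) ≠ 0 := ne_of_gt (by linarith)
      field_simp
    rw [h2] at h1
    exact h1
  · exfalso; linarith

/-- **Lower bound on the ratio:** `1/(1 + x_t)² ≤ Z(2t)/Z(t)²` (because `x_{2t} ≥ 0`); equivalently `δ ≤ 1 − 1/N_eff²`. -/
theorem inv_sq_le_ratio (h : HasSpectralDatum z) (m : ℕ) :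
    1 / (1 + exc z (m + 2)) ^ 2 ≤ z (2 * (m + 2)) / z (m + 2) ^ 2 := by
  have hx1 := exc_nonneg h m
  have hx2 : 0 ≤ exc z (2 * (m + 2)) := by
    rw [show 2 * (m + 2) = (2 * m + 2) + 2 from by ring]; exact exc_nonneg h _
  rcases ratio_eq_exc (z := z) m with hr | h0
  · rw [hr]
    exact div_le_div_of_nonneg_right (by linarith) (sq_nonneg _)
  · exfalso; linarith

end OneBox

/-! ## §1 The dictionary for Wilson's cold box: `1 − 1/(1+x) ≤ δᶜ_β(L) ≤ 1 − 1/(1+x)²`, `x = x_{⌊L/4⌋}(β, L³)` -/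

section Model

variable {G : Type} [Group G] [TopologicalSpace G] [IsTopologicalGroup G] [CompactSpace G]
  [MeasurableSpace G] [BorelSpace G]

/-- The thermal trace excess of the cold box: `x_{⌊L/4⌋}(β, L³) = Z_β(L³×⌊L/4⌋)/λ₀(β,L³)^{⌊L/4⌋} − 1 = Σ_{i≠0}(λᵢ/λ₀)^{⌊L/4⌋}`
(the tree's `AspectBootstrap.exc` of the time-slot sequence of Wilson's partition function; `N_eff = 1 + x` is the thermal
multiplicity of the ground state at temperature `1/⌊L/4⌋` in lattice units). -/
def coldExcess (r : LatticeRep G) (β : ℝ) (L : ℕ) : ℝ :=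
  exc (wilsonFinTorusPartition r.ρ β L L L) (L / 4)

/-- **δᶜ ≥ 1 − 1/(1+x)** (`β ≥ 0`, `L ≥ 8`): a large thermal excess makes the cold box impure. -/
theorem one_sub_inv_le_coldDefect (r : LatticeRep G) {β : ℝ} (hβ : 0 ≤ β) {L : ℕ} (hL : 8 ≤ L) :
    1 - 1 / (1 + coldExcess r β L) ≤ coldDefect r.ρ β L := by
  obtain ⟨m, hm⟩ : ∃ m, L / 4 = m + 2 := ⟨L / 4 - 2, by omega⟩
  have hd : HasSpectralDatum (wilsonFinTorusPartition r.ρ β L L L) :=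
    tracePositive r hβ L L L (by omega) (by omega) (by omega)
  have h := ratio_le_inv_one_add_exc hd m
  unfold coldExcess coldDefect
  rw [hm]
  linarith

/-- **δᶜ ≤ 1 − 1/(1+x)²** (`β ≥ 0`, `L ≥ 8`): conversely the defect controls the excess from below. -/
theorem coldDefect_le_one_sub_inv_sq (r : LatticeRep G) {β : ℝ} (hβ : 0 ≤ β) {L : ℕ} (hL : 8 ≤ L) :
    coldDefect r.ρ β L ≤ 1 - 1 / (1 + coldExcess r β L) ^ 2 := by
  obtain ⟨m, hm⟩ : ∃ m, L / 4 = m + 2 := ⟨L / 4 - 2, by omega⟩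
  have hd : HasSpectralDatum (wilsonFinTorusPartition r.ρ β L L L) :=
    tracePositive r hβ L L L (by omega) (by omega) (by omega)
  have h := inv_sq_le_ratio hd m
  unfold coldExcess coldDefect
  rw [hm]
  linarith

/-- `0 ≤ coldExcess r β L` for `β ≥ 0`, `L ≥ 8` (the thermal trace excess of a trace-positive box is non-negative). -/
theorem coldExcess_nonneg (r : LatticeRep G) {β : ℝ} (hβ : 0 ≤ β) {L : ℕ} (hL : 8 ≤ L) : 0 ≤ coldExcess r β L := by
  obtain ⟨m, hm⟩ : ∃ m, L / 4 = m + 2 := ⟨L / 4 - 2, by omega⟩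
  have hd : HasSpectralDatum (wilsonFinTorusPartition r.ρ β L L L) :=
    tracePositive r hβ L L L (by omega) (by omega) (by omega)
  unfold coldExcess; rw [hm]; exact exc_nonneg hd m

/-- `coldDefect r.ρ β L ≤ 1` for `β ≥ 0`, `L ≥ 8` (from the lower ratio bound `1/(1+x)² ≤ Z(2t)/Z(t)²`). -/
theorem coldDefect_le_one (r : LatticeRep G) {β : ℝ} (hβ : 0 ≤ β) {L : ℕ} (hL : 8 ≤ L) : coldDefect r.ρ β L ≤ 1 := by
  have h := coldDefect_le_one_sub_inv_sq r hβ hL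
  have : 0 ≤ 1 / (1 + coldExcess r β L) ^ 2 := by positivity
  linarith

/-! ## §2 The femto tower (ONE physical stub, per representation) and the femto impurity it forces (PROVED equivalence) -/

/-- **Femto tower at `(G, r)`** — at every FIXED lattice box `L ≥ 8` the thermal trace excess of the cold box diverges as
`β → ∞`: `x_{⌊L/4⌋}(β, L³) → +∞` (the zero-mode / toron tower collapsing onto the ground state; route-posited predicate, the
per-rep body of the stub `FemtoTowerSC`).  TRUE (physics-certain, rigorously open here) for every compact connected Lie `G` of
positive dimension and faithful `r` — `U(1)` INCLUDED (`x ≍ β^{3/2}`); FALSE for finite `G`. -/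
def FemtoTowerAt (r : LatticeRep G) : Prop :=
  ∀ L : ℕ, 8 ≤ L → Tendsto (fun β : ℝ => coldExcess r β L) atTop atTop

/-- **Femto impurity at `(G, r)`** — at every FIXED lattice box `L ≥ 8` the cold purity defect tends to ONE as `β → ∞`
(route-posited predicate; equivalent to `FemtoTowerAt r`: `femtoImpurityAt_iff_femtoTowerAt`). -/
def FemtoImpurityAt (r : LatticeRep G) : Prop :=
  ∀ L : ℕ, 8 ≤ L → Tendsto (fun β : ℝ => coldDefect r.ρ β L) atTop (𝓝 1)

/-- **Quantitative femto tower (typed rung, OPEN):** the excess grows at least like `c·β^κ`.  Morse–Bott count at the generic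
flat stratum predicts `κ = 3·rank(G)/2` (plus possible logarithms from singular strata); for `U(1)`, where the flat set is smooth,
`κ = 3/2` exactly and the statement is a Gaussian/theta-function computation (the line's cheapest rung). -/
def FemtoRateAt (r : LatticeRep G) (κ : ℝ) : Prop :=
  ∀ L : ℕ, 8 ≤ L → ∃ c : ℝ, 0 < c ∧ ∃ β₁ : ℝ, ∀ β : ℝ, β₁ ≤ β → c * β ^ κ ≤ coldExcess r β L

/-- A power-law lower bound `c·β^κ ≤ coldExcess r β L` (`κ > 0`) at every fixed box implies the femto tower `FemtoTowerAt r`. -/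
theorem femtoTowerAt_of_rate (r : LatticeRep G) {κ : ℝ} (hκ : 0 < κ) (h : FemtoRateAt r κ) : FemtoTowerAt r := by
  intro L hL
  obtain ⟨c, hc, β₁, hβ₁⟩ := h L hL
  have hpow : Tendsto (fun β : ℝ => c * β ^ κ) atTop atTop :=
    Tendsto.const_mul_atTop hc (tendsto_rpow_atTop hκ)
  refine tendsto_atTop_mono' atTop ?_ hpow
  exact (eventually_ge_atTop β₁).mono fun β hβ => hβ₁ β hβ

/-- **Tower ⇒ impurity** (PROVED): `x → ∞` and `δᶜ ≥ 1 − 1/(1+x)`, `δᶜ ≤ 1`. -/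
theorem femtoImpurityAt_of_tower (r : LatticeRep G) (h : FemtoTowerAt r) : FemtoImpurityAt r := by
  intro L hL
  have hx := h L hL
  -- lower envelope `1 - 1/(1+x β) → 1`
  have h1 : Tendsto (fun β : ℝ => 1 + coldExcess r β L) atTop atTop := tendsto_atTop_add_const_left _ 1 hx
  have h2 : Tendsto (fun β : ℝ => (1 + coldExcess r β L)⁻¹) atTop (𝓝 0) := h1.inv_tendsto_atTop
  have h3 : Tendsto (fun β : ℝ => 1 - 1 / (1 + coldExcess r β L)) atTop (𝓝 1) := by
    have := (tendsto_const_nhds (x := (1 : ℝ)) (f := (atTop : Filter ℝ))).sub h2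
    simpa only [one_div, sub_zero] using this
  refine tendsto_of_tendsto_of_tendsto_of_le_of_le' h3 tendsto_const_nhds ?_ ?_
  · exact (eventually_ge_atTop 0).mono fun β hβ => one_sub_inv_le_coldDefect r hβ hL
  · exact (eventually_ge_atTop 0).mono fun β hβ => coldDefect_le_one r hβ hL

/-- **Impurity ⇒ tower** (PROVED): `δᶜ → 1` and `1 − δᶜ ≥ 1/(1+x)²` force `x → ∞`. -/
theorem femtoTowerAt_of_impurity (r : LatticeRep G) (h : FemtoImpurityAt r) : FemtoTowerAt r := by
  intro L hL
  have hδ := h L hL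
  rw [tendsto_atTop]
  intro b
  -- WLOG `b ≥ 0`; eventually `δᶜ > 1 - 1/(1 + b')²` with `b' = max b 0`
  set b' : ℝ := max b 0 with hb'
  have hb'0 : 0 ≤ b' := le_max_right _ _
  have hlt : 1 - 1 / (1 + b') ^ 2 < 1 := by
    have : 0 < 1 / (1 + b') ^ 2 := by positivity
    linarith
  have hev : ∀ᶠ β : ℝ in atTop, 1 - 1 / (1 + b') ^ 2 < coldDefect r.ρ β L := hδ.eventually (Ioi_mem_nhds hlt)
  filter_upwards [hev, eventually_ge_atTop (0 : ℝ)] with β hβ hβ0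
  have hup := coldDefect_le_one_sub_inv_sq r hβ0 hL
  have hx0 := coldExcess_nonneg r hβ0 hL
  have hcmp : 1 / (1 + coldExcess r β L) ^ 2 < 1 / (1 + b') ^ 2 := by linarith
  have hpos : 0 < (1 + coldExcess r β L) := by linarith
  have hsq : (1 + b') ^ 2 < (1 + coldExcess r β L) ^ 2 := by
    by_contra hcon
    push Not at hcon
    have : 1 / (1 + b') ^ 2 ≤ 1 / (1 + coldExcess r β L) ^ 2 :=
      one_div_le_one_div_of_le (by positivity) hcon
    linarith
  have hb'x : b' < coldExcess r β L := by
    nlinarith [hsq, hb'0, hx0]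
  exact le_of_lt (lt_of_le_of_lt (le_max_left _ _) hb'x)

/-- **Femto impurity ⟺ femto tower** at `(G, r)`: `δᶜ_β(L) → 1` at every fixed `L ≥ 8` iff the thermal excess diverges. -/
theorem femtoImpurityAt_iff_femtoTowerAt (r : LatticeRep G) : FemtoImpurityAt r ↔ FemtoTowerAt r :=
  ⟨femtoTowerAt_of_impurity r, femtoImpurityAt_of_tower r⟩

/-! ## §3 The wall (PROVED modulo the per-rep tower): no β-uniform witness, window escape, selectors diverge, no upward heredity -/

/-- **`E` with the box chosen BEFORE the coupling, at `(G, r)`:** SOME fixed lattice box `L ≥ 8` is `θ`-pure at ALL large `β`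
(route-posited strengthening of the body of `BasinRung.ColdExitAt θ`; the form a β-UNIFORM finite-lattice argument would prove). -/
def UniformExitAtRep (r : LatticeRep G) (θ : ℝ) : Prop :=
  ∃ L : ℕ, 8 ≤ L ∧ ∃ β₁ : ℝ, ∀ β : ℝ, β₁ ≤ β → coldDefect r.ρ β L ≤ θ

/-- **Upward heredity of purity in `β` at fixed lattice size, at `(G, r)`** — the β-REVERSAL of ideator idea-11's `M♭₂ =
BasinHereditySlackSC` (which transports purity DOWNWARD, `β' ↦ β ≤ β'`): beyond `β₀`, `ε`-purity of the box `L` at `β` gives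
`ε'`-purity of the SAME lattice box at every `β' ≥ β` (route-posited predicate, refuted below given cofinal exits). -/
def UpwardHeredityAtRep (r : LatticeRep G) (ε ε' : ℝ) : Prop :=
  ∃ β₀ : ℝ, ∀ β β' : ℝ, β₀ ≤ β → β ≤ β' → ∀ L : ℕ, 8 ≤ L → coldDefect r.ρ β L ≤ ε → coldDefect r.ρ β' L ≤ ε'

/-- **Eventual `θ`-impurity of every fixed box at `(G, r)`** — the WEAKEST hypothesis the wall needs at tolerance `θ`: for every lattice
box `L ≥ 8`, eventually in `β`, `δᶜ_β(L) > θ`.  Implied for every `θ < 1` by the femto tower (`eventualImpurityAt_of_femto`); for `θ < 1 − |Z(G)|⁻³`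
already implied by the degeneracy of 't Hooft's `|Z(G)|³` electric-flux sectors alone (`SU(2)`: `θ < 7/8`, rung `CentreFluxImpuritySU2` below). -/
def EventualImpurityAt (r : LatticeRep G) (θ : ℝ) : Prop :=
  ∀ L : ℕ, 8 ≤ L → ∀ᶠ β : ℝ in atTop, θ < coldDefect r.ρ β L

/-- Femto impurity forces eventual `θ`-impurity at every fixed box, for every `θ < 1`. -/
theorem eventualImpurityAt_of_femto (r : LatticeRep G) (hF : FemtoImpurityAt r) {θ : ℝ} (hθ : θ < 1) :
    EventualImpurityAt r θ :=
  fun L hL => (hF L hL).eventually (Ioi_mem_nhds hθ)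

/-- Eventual impurity is monotone in the tolerance: `θ' ≤ θ` and eventual `θ`-impurity give eventual `θ'`-impurity. -/
theorem eventualImpurityAt_mono (r : LatticeRep G) {θ θ' : ℝ} (hθθ' : θ' ≤ θ) (h : EventualImpurityAt r θ) :
    EventualImpurityAt r θ' :=
  fun L hL => (h L hL).mono fun _ hβ => lt_of_le_of_lt hθθ' hβ

/-- **No β-uniform witness** (PROVED from eventual `θ`-impurity at `r`): no fixed lattice box is `θ`-pure at all large `β`. -/
theorem not_uniformExitAtRep (r : LatticeRep G) {θ : ℝ} (hI : EventualImpurityAt r θ) :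
    ¬ UniformExitAtRep r θ := by
  rintro ⟨L, hL, β₁, h⟩
  obtain ⟨β, hβ, hβ₁⟩ := ((hI L hL).and (eventually_ge_atTop β₁)).exists
  exact absurd (h β hβ₁) (not_le.mpr hβ)

/-- **Trivial side of the threshold (PROVED):** for `θ ≥ 1` EVERY box is `θ`-pure (`δᶜ ≤ 1`), so the β-uniform form holds with `L = 8`, `β₁ = 0`. -/
theorem uniformExitAtRep_of_one_le (r : LatticeRep G) {θ : ℝ} (hθ : 1 ≤ θ) : UniformExitAtRep r θ :=
  ⟨8, le_rfl, 0, fun _ hβ => (coldDefect_le_one r hβ (le_refl 8)).trans hθ⟩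

/-- **Window escape** (PROVED from eventual `θ`-impurity at `r`): for every `L₁`, beyond some `β₂` NO box with `8 ≤ L ≤ L₁` is `θ`-pure —
the pure boxes leave every bounded window of lattice sizes. -/
theorem window_escape (r : LatticeRep G) {θ : ℝ} (hI : EventualImpurityAt r θ) (L₁ : ℕ) :
    ∃ β₂ : ℝ, ∀ β : ℝ, β₂ ≤ β → ∀ L : ℕ, 8 ≤ L → L ≤ L₁ → θ < coldDefect r.ρ β L := by
  have hev : ∀ᶠ β : ℝ in atTop, ∀ L ∈ Finset.Icc 8 L₁, θ < coldDefect r.ρ β L := by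
    rw [Filter.eventually_all_finset]
    intro L hLmem
    exact hI L (Finset.mem_Icc.mp hLmem).1
  obtain ⟨β₂, hβ₂⟩ := eventually_atTop.mp hev
  exact ⟨β₂, fun β hβ L hL hL₁ => hβ₂ β hβ L (Finset.mem_Icc.mpr ⟨hL, hL₁⟩)⟩

/-- **Every exit selector diverges** (PROVED from eventual `θ`-impurity at `r`): if `β ↦ L(β)` eventually witnesses `θ`-purity of the cold
box `L(β) ≥ 8`, then `L(β) → ∞` — in lattice units the pure boxes run away; `E` cannot be certified on a bounded family of lattices. -/
theorem selector_tendsto_atTop (r : LatticeRep G) {θ : ℝ} (hI : EventualImpurityAt r θ) (f : ℝ → ℕ)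
    (hf : ∀ᶠ β : ℝ in atTop, 8 ≤ f β ∧ coldDefect r.ρ β (f β) ≤ θ) : Tendsto f atTop atTop := by
  rw [tendsto_atTop]
  intro L₁
  obtain ⟨β₂, hβ₂⟩ := window_escape r hI L₁
  filter_upwards [hf, eventually_ge_atTop β₂] with β hβ hββ₂
  by_contra hcon
  push Not at hcon
  have := hβ₂ β hββ₂ (f β) hβ.1 hcon.le
  linarith [hβ.2]

/-- **No upward heredity** (PROVED from eventual `ε'`-impurity at `r`): if `θ`-pure cold boxes occur at cofinally many couplings (VERBATIM
the per-rep body of idea-12's `ExitsUnboundedAt θ`, implied by the seed `ColdExitAt θ`), then purity is NOT inherited upward in `β` at fixed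
lattice size: `¬ UpwardHeredityAtRep r θ ε'`.  (Downward heredity, idea-11's `M♭₂`, is untouched.) -/
theorem not_upwardHeredity (r : LatticeRep G) {θ ε' : ℝ} (hI : EventualImpurityAt r ε')
    (hK : ∀ β₁ : ℝ, ∃ β : ℝ, β₁ ≤ β ∧ ∃ L : ℕ, 8 ≤ L ∧ coldDefect r.ρ β L ≤ θ) :
    ¬ UpwardHeredityAtRep r θ ε' := by
  rintro ⟨β₀, h⟩
  obtain ⟨β, hβ₀, L, hL, hδ⟩ := hK β₀
  obtain ⟨β', ⟨hlt, hββ'⟩⟩ := ((hI L hL).and (eventually_ge_atTop β)).exists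
  exact absurd (h β β' hβ₀ hββ' L hL hδ) (not_le.mpr hlt)

/-- **RUNG (typed, OPEN; the line's cheapest prover target): centre-flux impurity of `SU(2)` boxes.**  For every `θ < 7/8` every fixed
lattice box of `SU(2)` (fundamental Wilson action) is eventually `θ`-impure: the `2³ = 8` electric-flux sectors ('t Hooft 1979) become
degenerate with the vacuum as `β → ∞` at fixed `L` (variational flux states: `E_e − E_0 ≲ C·L/β`), so `x ≥ 7 − o(1)` and `δᶜ ≥ 1 − 1/8 − o(1)`
by `one_sub_inv_le_coldDefect`.  Weaker than the tower, enough to refute `UniformExit24` (`not_uniformExit24_of_centreRung`).  Route-posited. -/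
def CentreFluxImpuritySU2 : Prop :=
  letI : MeasurableSpace (Matrix.specialUnitaryGroup (Fin 2) ℂ) := borel _
  haveI : BorelSpace (Matrix.specialUnitaryGroup (Fin 2) ℂ) := ⟨rfl⟩
  ∀ θ : ℝ, θ < 7 / 8 → EventualImpurityAt (fundamentalLatticeRep 2) θ

end Model

end Summit.QuantumFields.YangMills.Theorems.ColdExitSC.Negative.FemtoWall

end
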